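import Literature.Computability.MetaComplexity.UHSMachine
import HarnessLib

/-!
# Complexity meta: `K^t` upper bounds for strings computed in polynomial time from a short payload and an exponential ruler

Topic `Literature/Computability/MetaComplexity`. A generic device for time-bounded Kolmogorov
complexity upper bounds of the shape "`K^{poly(T)}(y) ≤ |payload| + O(log T)`" (as in Hirahara 2021,
proof of Thm. 3.12, p. 25: "the program `M` computes and outputs `R^{D_σ}(α; G_{s'}(σ'))` in time
`poly(ns/δ)`; we thus obtain `K^{poly(ns/δ)}(x | D) ≤ k + O(log s) + O(log s')`", and proof of Thm. 5.2,
p. 30: "`DP_k(x; z) · w` can be described using `m, d ∈ ℕ`, `z` and …"): whenever the target string is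
`g ⟨1^{2^ℓ} 0 u, payload⟩` for a POLYNOMIAL-TIME string function `g` (which may use the ruler `1^{2^ℓ}`
to expand binary numerals of size `≤ 2^ℓ` into unary), it is printed by the program
`⟨e, ⟨u, payload⟩⟩` (`|u| = ℓ`) of the composite machine "exponential pad on the first component, then
`g`" within `poly(2^ℓ + |payload|)` steps, whence, by the universality of `U` (`UniversalMachine.sim`),

* `UniversalMachine.exists_ktAt_le_of_FP` — **for every `g ∈ FP` there are a constant `c₀` and a
  polynomial `q` with `K^{q(2^{|u|} + |payload|)}(g ⟨expPad 1 u, payload⟩) ≤ |payload| + 2|u| + c₀`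
  for all `u, payload`.**

The machine is the sequential composite (per-input additive time,
`Turing.TM2ComputableAux.comp_outputsWithin`) of the exponential pad `expPad 1`
(`Complexity/ExpPadding.lean`, time `C·2^{|u|} + C`) applied to the first component by `mapFstAux`
(`Complexity/MapFstMachine.lean`) and a polynomial-time machine for `g` — the pattern (and the
bookkeeping lemma `eval_le_pow_of_le`) of `UHSMachine.lean` (Cor. 6.4), imported for that purpose.

## References

* S. Hirahara, ECCC TR21-058 (2021), proofs of Thm. 3.12 (p. 25) and Thm. 5.2 (p. 30).
* M. Li, P. Vitányi, *An Introduction to Kolmogorov Complexity and Its Applications*, §7.1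
  (resource-bounded complexity; upper bounds by explicit programs).
* S. Arora, B. Barak, *Computational Complexity: A Modern Approach*, CUP 2009, Thm. 1.9, §1.3.
-/

namespace Literature.Computability.MetaComplexity

open _root_.Computability Complexity Polynomial Turing

namespace UniversalMachine

variable (U : UniversalMachine)

/-- **The ruler machine**: for `g ∈ FP` there is a TM2 machine which, on `⟨u, payload⟩`, outputs
`g ⟨expPad 1 u, payload⟩ = g ⟨1^{2^{|u|}} 0 u, payload⟩` within `A · (2^{|u|} + |payload|)^B + A` steps
(exponential pad on the first component, then `g`; times add per input).
[Hirahara 2021 (ECCC TR21-058), proof of Thm. 3.12 (p. 25)] [cite: Hirahara2021, Thm. 3.12 (proof)] -/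
theorem exists_outputsWithin_ruler {g : List Bool → List Bool} (hg : g ∈ FP) :
    ∃ (M : TM2ComputableAux Bool Bool) (A B : ℕ), ∀ u payload : List Bool,
      M.OutputsWithin (boolPair u payload) (g (boolPair (expPad 1 u) payload))
        (A * (2 ^ u.length + payload.length) ^ B + A) := by
  obtain ⟨CE, ME, hME⟩ := exists_timeComputable_expPad (k := 1) le_rfl
  obtain ⟨qG, MG, hMG⟩ := hg
  obtain ⟨eG, -, heG⟩ := UHSParam.exists_pow_bound qG
  refine ⟨(mapFstAux ME).comp MG, 11 ^ (2 ^ eG) + (2 * CE + 25), 2 ^ eG + 1, fun u payload => ?_⟩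
  set P := boolPair (expPad 1 u) payload with hP
  -- stage 1: the pad on the first component
  have h1 : (mapFstAux ME).OutputsWithin (boolPair u payload) P
      ((CE * 2 ^ (u.length ^ 1) + CE) + 3 * (expPad 1 u).length + 2 * (boolPair u payload).length + 6) := by
    have h := outputsWithin_mapFstAux ME (z := boolPair u payload) (out := expPad 1 u)
      (m := CE * 2 ^ (u.length ^ 1) + CE) (by simpa using hME u)
    rwa [readRest_boolPair] at h
  -- stage 2: `g`
  have h2 : MG.OutputsWithin P (g P) (qG.eval P.length) := hMG P
  have h := TM2ComputableAux.comp_outputsWithin _ MG h1 h2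
  refine h.mono ?_
  -- time bookkeeping in `Z = 2^{|u|} + |payload|`
  set Z := 2 ^ u.length + payload.length with hZ
  have hZ1 : 1 ≤ Z := le_add_right Nat.one_le_two_pow
  have huZ : u.length ≤ Z := le_add_right (Nat.lt_two_pow_self).le
  have hlenE : (expPad 1 u).length = 2 ^ u.length + u.length + 1 := by rw [length_expPad, pow_one]
  have hlenup : (boolPair u payload).length = 2 * u.length + 2 + payload.length := length_boolPair u payload
  have h2Z : 2 ^ u.length ≤ Z := Nat.le_add_right _ _
  have hpZ : payload.length ≤ Z := Nat.le_add_left _ _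
  have hlenP : P.length ≤ 9 * Z := by
    have : P.length = 2 * (2 ^ u.length + u.length + 1) + 2 + payload.length := by
      rw [hP, length_boolPair, hlenE]
    omega
  have hqG : qG.eval P.length ≤ 11 ^ (2 ^ eG) * Z ^ (2 ^ eG) := eval_le_pow_of_le heG hZ1 hlenP
  have hrest : CE * 2 ^ (u.length ^ 1) + CE + 3 * (expPad 1 u).length + 2 * (boolPair u payload).length + 6 ≤
      (2 * CE + 25) * Z := by
    have hA : CE * 2 ^ u.length ≤ CE * Z := Nat.mul_le_mul_left CE h2Z
    have hB : CE ≤ CE * Z := Nat.le_mul_of_pos_right CE hZ1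
    rw [pow_one, hlenE, hlenup]
    calc CE * 2 ^ u.length + CE + 3 * (2 ^ u.length + u.length + 1) + 2 * (2 * u.length + 2 + payload.length) + 6
        ≤ 2 * (CE * Z) + 25 * Z := by omega
      _ = (2 * CE + 25) * Z := by ring
  set B := 2 ^ eG + 1 with hB
  have hZB : Z ^ (2 ^ eG) ≤ Z ^ B := Nat.pow_le_pow_right hZ1 (Nat.le_succ _)
  have hZ1B : Z ≤ Z ^ B := by
    calc Z = Z ^ 1 := (pow_one Z).symm
      _ ≤ Z ^ B := Nat.pow_le_pow_right hZ1 (by rw [hB]; exact Nat.le_add_left 1 _)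
  calc qG.eval P.length + (CE * 2 ^ (u.length ^ 1) + CE + 3 * (expPad 1 u).length +
          2 * (boolPair u payload).length + 6)
      ≤ 11 ^ (2 ^ eG) * Z ^ (2 ^ eG) + (2 * CE + 25) * Z := add_le_add hqG hrest
    _ ≤ 11 ^ (2 ^ eG) * Z ^ B + (2 * CE + 25) * Z ^ B :=
        add_le_add (Nat.mul_le_mul_left _ hZB) (Nat.mul_le_mul_left _ hZ1B)
    _ = (11 ^ (2 ^ eG) + (2 * CE + 25)) * Z ^ B := by ring
    _ ≤ (11 ^ (2 ^ eG) + (2 * CE + 25)) * Z ^ B + (11 ^ (2 ^ eG) + (2 * CE + 25)) := Nat.le_add_right _ _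

/-- **`K^t` upper bound through a ruler program.** For every `g ∈ FP` there are a constant `c₀` and a
polynomial `q` such that for all strings `u, payload`,
`K^{q(2^{|u|} + |payload|)}(g ⟨expPad 1 u, payload⟩) ≤ |payload| + 2|u| + c₀`: the string is printed
by the program `⟨e, ⟨u, payload⟩⟩` of the ruler machine (`exists_outputsWithin_ruler`) through the
universality of `U` (`sim`: overhead polynomial `p`, code `e`; `q = p ∘ (A X^B + A)`,
`c₀ = 2|e| + 4`). With `|u| = O(log T)` this is the form "`K^{poly(T)}(y) ≤ |payload| + O(log T)`" of the
paper's explicit-program upper bounds. [Hirahara 2021 (ECCC TR21-058), proofs of Thm. 3.12 (p. 25) and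
Thm. 5.2 (p. 30); Li–Vitányi, §7.1] [cite: Hirahara2021, Thm. 3.12 (proof)] -/
theorem exists_ktAt_le_of_FP {g : List Bool → List Bool} (hg : g ∈ FP) :
    ∃ (c₀ : ℕ) (q : Polynomial ℕ), ∀ u payload : List Bool,
      U.ktAt (q.eval (2 ^ u.length + payload.length)) (g (boolPair (expPad 1 u) payload)) ≤
        payload.length + 2 * u.length + c₀ := by
  obtain ⟨M, A, B, hM⟩ := exists_outputsWithin_ruler hg
  obtain ⟨e, p, hsim⟩ := U.exists_ktAt_le_of_outputsWithin M
  refine ⟨2 * e.length + 4, p.comp (C A * X ^ B + C A), fun u payload => ?_⟩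
  have h := hsim (boolPair u payload) _ _ (hM u payload)
  rw [eval_comp, eval_add, eval_mul, eval_C, eval_pow, eval_X]
  refine h.trans_eq ?_
  rw [length_boolPair]; push_cast; ring

end UniversalMachine

end Literature.Computability.MetaComplexity
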